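import Summits.ABC.IUTFork.Joshi.ThetaJoshiConstruction
import HarnessLib

/-!
# Joshi, ATS III §6.5–§6.6: the trivial lift, Lemma 6.5.2, Proposition 6.6.1 and the locus `Θ̃^{B_E}_Joshi` (file 1 of 2)

Record-only TYPING file of the abc-iut cell, block E («type Joshi's construction, test vs S», rung LADDER-ABC:A2.E),
seat abc-iut-E-t11, slot T-11 of `HOME/plan/E/ASSIGNMENTS.md` = OBJECTS.tsv rows O-022 / O-023, node ids J3:Lem6.5.2,
J3:Prop6.6.1, J3:Def6.6.1.1 (file 2, `Joshi/ThetaJoshiAdelic.lean`, same seat: J3:Thm6.7.1, J3:Thm6.7.1.1, J3:Rmk6.7.1.2,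
J3:Thm6.8.1, J3:Def6.8.3, J3:Lem6.9.1, §6.9.1, J3:Def6.10.2, (6.10.4), §6.10.1, §6.10.2). Source: K. Joshi, *Construction of
Arithmetic Teichmüller Spaces III: A `Rosetta Stone' and a proof of Mochizuki's Corollary 3.12*, arXiv:2401.13508 **v4**
(unrefereed, «Preliminary version for comments») = bib `Joshi2024ATS3`, lit key `paper:arxiv-2401.13508`; locators
«p.N l.a–b» = PDF page N, lines a–b of the cell's render `HOME/lit/renders/Joshi-arxiv-2401.13508/pNNNN.txt` (printed
page = N − 1). TAKES NO SIDE on [IUTchIII] Cor. 3.12, on Joshi's claims, or on Mochizuki's report on them; typed ≠ proved;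
typed AS A CANDIDATE ≠ endorsed. Nothing is asserted: Joshi's DATA are fields / `def`s AS HE DEFINES THEM, every
statement he ASSERTS is a `Prop`-valued `def` tagged `@[claim "Joshi2024ATS3" "disputed"]` («disputed» = the registered
status word recording that a dispute exists in print, E-PLAN ruling R6), and a property that FOLLOWS from the typed
signature is a proved `theorem` (a «discharged» row).

BUILT ON slot T-10's landed carriers (`Joshi/ThetaJoshiConstruction.lean`, abc-iut-E-t10): `ATS3.CollationDatum` (`ℓ⋇`,
`V_{L′} ⊃ V^{odd,ss}`, closed classical points, Mochizuki's Adelic Ansatz `Σ̃_{L′}` = `adelicAnsatz`, `w`-components) and,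
per place `w`, `ATS3.ThetaLiftDatum (O_E) (B_E) (Y w)` (maximal ideals `𝔪_{y′}`, residue maps `ψ_{y′}`, Teichmüller lifts,
norms `|·|_ρ`, theta value `ξ_{1;K_{y′}}`, Tate parameter `q_{X/E,y′}`, `t_{K_{y′}}`, admissible lifts Def. 6.4.3.1). This file
adds the ADELIC FAMILY of lift data (`AdelicLiftDatum`, §0) with the extra §5–§6 data that §6.5–§6.10 read, and types:
* §1 (6.5.1) the trivial lift `Ξ_{z,w} = ([1],…,[1])` at `w ∉ V^{odd,ss}`; Lem. 6.5.2 `|[1]|_{B_E,ρ} = 1` (PROVED); the lifts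
  `Ξ_{z,w}` at an arbitrary place (`liftsAt`) and their existence (PROVED from [J-IIp] Thm. 8.1.1 typed as T-10's
  hypothesis `TeichLiftExists`);
* §2 Prop. 6.6.1 «admissible lifts and Tate parameters»: the residue equalities `ψ_j(Ξ_j) = ψ_j([z_j]) = ξ_{1,K_{y′_j}}`
  are T-10's `resid_of_isAdmissibleLift` (PROVED there); the printed identification «`ξ_{1,K_{y′_j}} = q_{X/E′_w,y′_j}`» is
  isolated as the hypothesis `XiOneIsTateParameter`, and `prop661_iff` shows the proposition AS PRINTED is equivalent to
  it over the signature;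
* §3 Def. 6.6.1.1 the theta-values locus `Θ̃^{B_E}_Joshi ⊂ B_E^{ℓ⋇}` at every `w ∈ V_{L′}` ((6.6.1.2)/(6.6.1.3) PROVED as
  case lemmas; this is the set BEFORE the §6.7 enlargement, which is file 2's `thetaLocusBEenl`).

MERGE-DEBT (ASSIGNMENTS §0.3): the §5 rings `B_dR`, `B̃_E` and the §5.3 enlargement data (`G_E ↷ B_E`, `φ`, `Aut(G_E)`-twists,
closed convex hulls) are slot T-09's objects and are carried here as bare fields (types / functions / a closure
operator) with locators; the §6.10.2 descent data duplicate T-10's `ModuliDescentDatum` at the level of the rings (T-06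
owns `V ≃ V_{L_mod}`). Deliberately NOT here: §7 sizes and Thm. 7.3.1 (T-12, `FundamentalEstimateBL.lean`, whose interim
`ATS3.AdelicThetaDatum` this family is meant to instantiate: `Idx`/`Xi`/`locus` ↔ file 2's `thetaLocusBL`); any binding
to OUR `Cor312*`/`Thm311*` decls (DEFS-FREEZE; the §6.10.1 reading «`Ξ_z` = Θ-pilot object» is bound ONLY in
`Joshi/Dictionary.lean`, rows D-02/D-03, `Dictionary.datum` / `BaseIsThetaPilot`).
-/

noncomputable section

open Set

namespace Summit.ABC.IUTFork.Joshi.ATS3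

/-! ## §0 The adelic family of lift data -/

/-- **The ADELIC FAMILY of theta-lift data** over a collation datum `A` (slot T-10): for every place `w ∈ V_{L′}` the ring
`B_{E′_w}` (`E′_w = L′_w`; parameter family `B`, an `O_{E′_w}`-algebra, parameter family `OE`) with T-10's lift data
`lift w : ThetaLiftDatum (O_{E′_w}) (B_{E′_w}) |Y_{ℂ_p^♭,L′_w}|` (§6.4.1–§6.4.3, p. 45 l. 43 – p. 48 l. 13: «I will now apply the
construction … for each `w ∈ V^{odd,ss}_p`»; Def. 6.6.1.1 p. 49 l. 74–76: «`Θ̃^{B_E}_Joshi ⊂ B_E^{ℓ⋇}` is defined for all `w ∈ V_{L′}`»),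
together with the further data §6.5–§6.10 READ: the Teichmüller element `[1]` ((6.5.1), p. 48 l. 20–21) with `|1|_{ℂ_p^♭} = 1`;
`|0|_{K_{y′}} = 0` and `|ξ_{1;K_{y′}}|_{K_{y′}} > 0` (theta values are non-zero: `|ξ_1| = |q^{1/2ℓ}|`, [J-IIp] §5.1 — read by the
proof of Lem. 6.9.1); the §5.3 ENLARGEMENT DATA (p. 40 l. 38 – p. 41 l. 39: the action `G_E ↷ B_E`, the Frobenius `φ` of `B_E`,
the twists `S ↦ S^σ`, `σ ∈ Aut(G_E)` — «the image of `S` under this new [σ-twisted] action of `G_E` on `B_E`», not further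
specified in print —, the closed convex hull for the Fréchet topology); `B_dR ⊃ B_E` ((5.2.4.1), §6.8); `B̃_E = B ⊗_{ℚ_p} E ⊃ B_E`
((5.2.5.5), (6.9.1.2)); and the §6.10.2 descent data (`V_{L_mod} ≃ V ⊂ V_{L′}`, the trace maps `B_{L′_w} → B_{L_mod,v}`, p. 53
l. 21–26). SIGNATURE only (slot T-09 / T-06 objects as bare fields, merge-debt); nothing of Joshi's is asserted.
[claim: Joshi2024ATS3, status: disputed] -/
structure AdelicLiftDatum (A : CollationDatum) (OE B : A.V → Type) [∀ w, CommRing (OE w)] [∀ w, CommRing (B w)]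
    [∀ w, Algebra (OE w) (B w)] : Type 1 where
  /-- T-10's theta-lift data over `B_{E′_w}` at every place `w` (§6.4.2–§6.4.3). -/
  lift : ∀ w : A.V, ThetaLiftDatum (OE w) (B w) (A.Y w)
  /-- `1 ∈ O_{ℂ_p^♭}`, whose Teichmüller lift is «the Teichmüller element `[1] ∈ W(O_{ℂ_p^♭}) ⊂ B_E`» ((6.5.1), p. 48 l. 20–21). -/
  oneFlat : ∀ w : A.V, (lift w).Cflat
  /-- `[1] = 1` in `B_E` (the Teichmüller map is multiplicative and unital). -/
  teich_oneFlat : ∀ w, (lift w).teich (oneFlat w) = 1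
  /-- `|1|_{ℂ_p^♭} = 1` ([FF18 Déf. 1.4.1], quoted by Lem. 6.5.2, p. 48 l. 24–25). -/
  absFlat_oneFlat : ∀ w, (lift w).absFlat (oneFlat w) = 1
  /-- `|0|_{K_{y′}} = 0` in every residue field. -/
  absK_zero : ∀ w (y : A.Y w), (lift w).absK y 0 = 0
  /-- theta values are non-zero: `0 < |ξ_{1;K_{y′}}|_{K_{y′}}` ([J-IIp] §5.1 / Thm. 8.1.1: `|ξ_1|_K = |q^{1/2ℓ}|`; used with [FF18
  Lem. 2.2.13] in the proof of Lem. 6.9.1, p. 52 l. 5–7). -/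
  absK_xi_pos : ∀ w (y : A.Y w), 0 < (lift w).absK y ((lift w).xi y)
  /-- the Galois group `G_E = G_{E′_w}` (type of; §5.3.1). -/
  G : A.V → Type
  /-- «the natural action of … `G_E` on `B_E`» by ring automorphisms (§5.3.1, p. 40 l. 47–49). -/
  galAct : ∀ w, G w → B w ≃+* B w
  /-- «`φ` is the Frobenius morphism of `B_E`» (§5.3.2, p. 41 l. 32). -/
  frob : ∀ w, B w ≃+* B w
  /-- `Aut(G_E)` (type of; §5.3.1). -/
  AutG : A.V → Type
  /-- the identity automorphism of `G_E`. -/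
  autId : ∀ w, AutG w
  /-- `S ↦ S^σ` on subsets of `B_E^{ℓ⋇}`: «let `S^σ` be the image of `S` under this new [pre-composed with `σ ∈ Aut(G_E)`,
  (5.3.1.1)] action of `G_E` on `B_E` … applied verbatim to … `B_E^{ℓ⋇}`» (p. 41 l. 1–7) — abstract (slot T-09's §5.3.1). -/
  twist : ∀ w, AutG w → Set (Fin A.lstar → B w) → Set (Fin A.lstar → B w)
  /-- the untwisted image of `S` under the `G_E`-action contains `S` (`e ∈ G_E`) — the only property of the twists used. -/
  subset_twist_autId : ∀ w (S : Set (Fin A.lstar → B w)), S ⊆ twist w (autId w) S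
  /-- §5.3.3 (p. 41 l. 35–39): «the closure of its convex hull … the smallest, closed, convex subset containing `S`» for the
  Fréchet topology of `B_E^{ℓ⋇}`, as a closure operator on subsets. -/
  conv : ∀ w, ClosureOperator (Set (Fin A.lstar → B w))
  /-- `B_dR` (§5.2.4; type of). -/
  BdR : A.V → Type
  /-- the map `B_E → B_dR` of (5.2.4.1). -/
  toBdR : ∀ w, B w → BdR w
  /-- (5.2.4.1) «`B_E ↪ B_dR`» (proof of Thm. 6.8.1, p. 51 l. 34–35). -/
  toBdR_injective : ∀ w, Function.Injective (toBdR w)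
  /-- `B̃_E = B ⊗_{ℚ_p} E = B_E^{⊕[E_0:ℚ_p]}` (§5.2.5, (5.2.5.3)–(5.2.5.4); type of). -/
  Btil : A.V → Type
  /-- the diagonal embedding `B_E ↪ B̃_E` (5.2.5.5). -/
  toBtil : ∀ w, B w → Btil w
  /-- `V_{L_mod}`, the places of the field of moduli (§3.1 (4); §6.10.2). -/
  Vmod : Type
  /-- the bijection `V_{L_mod} ≃ V ⊂ V_{L′}` (§3.3 (14); p. 53 l. 21–24 «the unique prime `w ∈ V` of `L′` lying over `v`»). -/
  sel : Vmod → A.V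
  /-- … is a bijection onto `V`: injective. -/
  sel_injective : Function.Injective sel
  /-- the rings `B_{L_mod,v}` (type of). -/
  Bmod : Vmod → Type
  /-- «the trace morphism `B_{L′_w} → B_{L_mod,v}`» (p. 53 l. 23–26). -/
  trace : ∀ v : Vmod, B (sel v) → Bmod v

namespace AdelicLiftDatum

variable {A : CollationDatum} {OE B : A.V → Type} [∀ w, CommRing (OE w)] [∀ w, CommRing (B w)]
  [∀ w, Algebra (OE w) (B w)] (𝔇 : AdelicLiftDatum A OE B)

/-! ## §1 The trivial lift (6.5.1), Lemma 6.5.2, the lifts `Ξ_{z,w}` at an arbitrary place -/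

/-- **(6.5.1) (p. 48 l. 17–21)**: «If `w ∈ V_{L′} − V^{odd,ss}`, then one defines `Ξ_{z,w} = ([1],…,[1]) ∈ B_E^{ℓ⋇}`. Here
`[1] ∈ W(O_{ℂ_p^♭}) ⊂ B_E` is the Teichmüller element.» [claim: Joshi2024ATS3, status: disputed] -/
def trivialLift (w : A.V) : Fin A.lstar → B w := fun _ => (𝔇.lift w).teich (𝔇.oneFlat w)

/-- `([1],…,[1]) = (1,…,1)`. [folklore] -/
theorem trivialLift_eq_one (w : A.V) : 𝔇.trivialLift w = 1 :=
  funext fun _ => 𝔇.teich_oneFlat w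

/-- **[J-III] Lemma 6.5.2 (p. 48 l. 22–25)**: «For each `ρ ∈ (0,1) ⊂ ℝ` one has `|[1]|_{B_E,ρ} = 1`. Proof. Clear from [FF18, Ch. 1,
Déf. 1.4.1].» PROVED over the signature (`|[z]|_ρ = |z|_{ℂ_p^♭}`, T-10's field `norm_teich`, and `|1|_{ℂ_p^♭} = 1`), for all
`ρ ∈ (0,1]`. [claim: Joshi2024ATS3, status: disputed] -/
theorem lem652 (w : A.V) {ρ : ℝ} (h0 : 0 < ρ) (h1 : ρ ≤ 1) : (𝔇.lift w).norm ρ ((𝔇.lift w).teich (𝔇.oneFlat w)) = 1 := by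
  rw [(𝔇.lift w).norm_teich ρ h0 h1, 𝔇.absFlat_oneFlat]

/-- Hence every coordinate of the trivial lift has norm `1` (read by Lem. 7.2.4, p. 54 l. 31–33). [folklore] -/
theorem norm_trivialLift (w : A.V) {ρ : ℝ} (h0 : 0 < ρ) (h1 : ρ ≤ 1) (j : Fin A.lstar) :
    (𝔇.lift w).norm ρ (𝔇.trivialLift w j) = 1 :=
  𝔇.lem652 w h0 h1

open scoped Classical in
/-- **The lifts `Ξ_{z,w}` at a place `w` from the Ansatz point `z`** (the notation of p. 48 l. 1–13, all choices `([z_j], λ)`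
allowed): T-10's admissible lifts of Def. 6.4.3.1 over the `w`-component of `z` if `w ∈ V^{odd,ss}` (p. 47 l. 42 – p. 48
l. 13), the single trivial lift `([1],…,[1])` of (6.5.1) otherwise. [claim: Joshi2024ATS3, status: disputed] -/
def liftsAt (w : A.V) (z : Fin A.lstar → A.Arith) : Set (Fin A.lstar → B w) :=
  if w ∈ A.Voddss then (𝔇.lift w).admissibleLifts (A.localAnsatz w) (A.wComponent z w) else {𝔇.trivialLift w}

/-- `liftsAt` at `w ∈ V^{odd,ss}` = the admissible lifts (Def. 6.4.3.1). [folklore] -/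
theorem liftsAt_of_mem {w : A.V} (hw : w ∈ A.Voddss) (z : Fin A.lstar → A.Arith) :
    𝔇.liftsAt w z = (𝔇.lift w).admissibleLifts (A.localAnsatz w) (A.wComponent z w) := by
  unfold liftsAt; rw [if_pos hw]

/-- `liftsAt` at `w ∉ V^{odd,ss}` = `{([1],…,[1])}` ((6.5.1)). [folklore] -/
theorem liftsAt_of_not_mem {w : A.V} (hw : w ∉ A.Voddss) (z : Fin A.lstar → A.Arith) :
    𝔇.liftsAt w z = {𝔇.trivialLift w} := by
  unfold liftsAt; rw [if_neg hw]

/-- At `w ∈ V^{odd,ss}`, for `z ∈ Σ̃_{L′}`: `Ξ ∈ liftsAt w z` iff `Ξ` is an admissible lift at `w` for `z` in T-10's sense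
(`CollationDatum.IsAdmissibleLiftAt`). [folklore] -/
theorem mem_liftsAt_iff_isAdmissibleLiftAt {w : A.V} (hw : w ∈ A.Voddss) {z : Fin A.lstar → A.Arith}
    (hz : z ∈ A.adelicAnsatz) (Ξ : Fin A.lstar → B w) :
    Ξ ∈ 𝔇.liftsAt w z ↔ A.IsAdmissibleLiftAt w (𝔇.lift w) z Ξ := by
  rw [𝔇.liftsAt_of_mem hw]
  exact ⟨fun h => ⟨hz, hw, h⟩, fun h => h.2.2⟩

/-- Lifts exist at every place for every Ansatz point, granted Teichmüller lifts of the theta values ([J-IIp] Thm. 8.1.1 as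
invoked p. 46 l. 48–49, T-10's hypothesis `TeichLiftExists`; `λ = 0`). [folklore] -/
theorem liftsAt_nonempty (hT : ∀ w, (𝔇.lift w).TeichLiftExists) {z : Fin A.lstar → A.Arith} (hz : z ∈ A.adelicAnsatz)
    (w : A.V) : (𝔇.liftsAt w z).Nonempty := by
  by_cases hw : w ∈ A.Voddss
  · rw [𝔇.liftsAt_of_mem hw]
    exact (𝔇.lift w).admissibleLifts_nonempty_of_teichLiftExists (hT w) (A.wComponent_mem_localAnsatz hz hw)
  · rw [𝔇.liftsAt_of_not_mem hw]; exact singleton_nonempty _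

/-! ## §2 Proposition 6.6.1 — admissible lifts and Tate parameters -/

/-- **[J-III] Proposition 6.6.1 (Admissible lifts and Tate parameters; p. 48 l. 26–54, proof p. 49 l. 1–14), AS PRINTED**: for
`z ∈ Σ̃_{L′}`, `w ∈ V^{odd,ss}_p`, an admissible theta-values lift `Ξ_{z,w} = (Ξ_{λ,K_{y′_1}},…,Ξ_{λ,K_{y′_{ℓ⋇}}})` at `w` and
`ψ_j : B_E → K_{y′_j}` «the natural quotient homomorphism arising by taking quotient modulo the (principal) maximal ideal
corresponding to the closed classical point `y′_j`»: «for `j = 1,…,ℓ⋇` one has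
`ψ_j(Ξ_{λ,K_{y′_j}}) = ψ_j([z_{w,j}]) = ξ_{1,K_{y′_j}} = q_{X/E′_w,y′_j} ∈ K_{y′_j}`, where `q_{X/E′_w,y′_j}` is the Tate parameter of `X/E′_w`
in the arithmetic holomorphic structure provided by `y′_j`» (proof: «`m_j = (t_{K_{y′_j}})` is a principal ideal and this
generator maps to zero … `[z_{w,j}]` is a Teichmüller lift of `ξ_{1,K_{y′_j}} = q_{X/E′_w,y′_j}`»; the printed `ψ_j(Ξ_{λ,K_{y′_1}})`,
p. 48 l. 43–44, is read as the `j`-th coordinate). Typed as the conjunction, over every admissible lift, of the residue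
equality `ψ_j(Ξ_j) = ξ_{1,K_{y′_j}}` (DERIVED: T-10's `resid_of_isAdmissibleLift`) and the identification `ξ_{1,K_{y′_j}} = q_{X/E′_w,y′_j}`
(theta value = Tate parameter; typed VERBATIM — cf. [J-IIp] §5.1 `|ξ_1| = |q|^{1/2ℓ}` and the «as printed» flag on [J-IIp] Thm.
8.1.1 (1); isolated in `XiOneIsTateParameter`, see `prop661_iff`). A `Prop`-valued definition, NOT asserted. -/
@[claim "Joshi2024ATS3" "disputed"]
def Prop661 : Prop :=
  ∀ z ∈ A.adelicAnsatz, ∀ w ∈ A.Voddss, ∀ Ξ : Fin A.lstar → B w,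
    (𝔇.lift w).IsAdmissibleLift (A.localAnsatz w) (A.wComponent z w) Ξ → ∀ j : Fin A.lstar,
      (𝔇.lift w).resid (A.wComponent z w j) (Ξ j) = (𝔇.lift w).xi (A.wComponent z w j) ∧
        (𝔇.lift w).xi (A.wComponent z w j) = (𝔇.lift w).tate (A.wComponent z w j)

/-- **The HYPOTHESIS CONTENT of Prop. 6.6.1, isolated**: «`ξ_{1,K_{y′_j}} = q_{X/E′_w,y′_j}`» (p. 48 l. 45–49; p. 49 l. 11–14; also p. 56
l. 29–35 «`α_w` is an `ℓ⋇`-tuple of Teichmüller lifts of the tuple `(q_{w,j})_{j=1,…,ℓ⋇}` consisting of the Tate parameters») — at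
every `w`-component point of every `z ∈ Σ̃_{L′}`, `w ∈ V^{odd,ss}`, the theta value `ξ_1` of T-10's datum IS the Tate parameter.
Candidate hypothesis, never asserted. -/
@[claim "Joshi2024ATS3" "disputed"]
def XiOneIsTateParameter : Prop :=
  ∀ z ∈ A.adelicAnsatz, ∀ w ∈ A.Voddss, ∀ j : Fin A.lstar,
    (𝔇.lift w).xi (A.wComponent z w j) = (𝔇.lift w).tate (A.wComponent z w j)

/-- The identification implies Prop. 6.6.1 as printed (its other equality being T-10's `resid_of_isAdmissibleLift`).
[folklore] -/
theorem prop661_of_xiOneIsTateParameter (h : 𝔇.XiOneIsTateParameter) : 𝔇.Prop661 :=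
  fun z hz w hw _ hΞ j => ⟨(𝔇.lift w).resid_of_isAdmissibleLift hΞ j, h z hz w hw j⟩

/-- **`prop661_iff`**: granted that Teichmüller lifts of the theta values exist (so that admissible lifts exist, T-10's
`admissibleLifts_nonempty_of_teichLiftExists`), Prop. 6.6.1 AS PRINTED is EQUIVALENT over the signature to the bare
identification `ξ_1 = q`. [folklore] -/
theorem prop661_iff (hT : ∀ w, (𝔇.lift w).TeichLiftExists) : 𝔇.Prop661 ↔ 𝔇.XiOneIsTateParameter := by
  refine ⟨fun h z hz w hw j => ?_, 𝔇.prop661_of_xiOneIsTateParameter⟩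
  obtain ⟨Ξ, hΞ⟩ :=
    (𝔇.lift w).admissibleLifts_nonempty_of_teichLiftExists (hT w) (A.wComponent_mem_localAnsatz hz hw)
  exact (h z hz w hw Ξ hΞ j).2

/-! ## §3 Definition 6.6.1.1 — the theta-values locus `Θ̃^{B_E}_Joshi ⊂ B_E^{ℓ⋇}` -/

/-- **[J-III] Definition 6.6.1.1 (p. 49 l. 15–76), the THETA-VALUES LOCUS `Θ̃^{B_E}_Joshi ⊂ B_E^{ℓ⋇}` at a fixed `w ∈ V_{L′}`**
(`E = E′_w = L′_w`), «the union of all the admissible theta-values-lifts» (l. 18–19): (1) if `w ∈ V^{odd,ss}_p`, «all admissible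
theta-values lifts `Ξ^{z_1,…,z_{ℓ⋇}}_{λ,z,w}` at a fixed `w` where `z` runs over `Σ̃_{L′}`», explicitly (6.6.1.2) `{([z_1] + i_1(λ)·t_{K_{y′_1}}, …,
[z_{ℓ⋇}] + i_{ℓ⋇}(λ)·t_{K_{y′_{ℓ⋇}}}) : for all [z_j] lifting ξ_{1,K_{y′_j}}, for all λ ∈ O_E, for all z ∈ Σ̃_{L′}}`; (2) if `w ∈ V_{L′} − V^{odd,ss}`,
(6.6.1.3) `Θ̃^{B_E}_Joshi = {Ξ_{z,w} : z ∈ Σ̃_{L′}} = {([1],…,[1])}`; «In particular, `Θ̃^{B_E}_Joshi ⊂ B_E^{ℓ⋇}` is defined for all `w ∈ V_{L′}`».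
The two cases are `thetaLocusBE_of_mem` / `thetaLocusBE_of_not_mem`. This is the set BEFORE the §6.7 enlargement (file 2,
`thetaLocusBEenl`). [claim: Joshi2024ATS3, status: disputed] -/
def thetaLocusBE (w : A.V) : Set (Fin A.lstar → B w) := ⋃ z ∈ A.adelicAnsatz, 𝔇.liftsAt w z

/-- `Ξ_{z,w} ∈ Θ̃^{B_E}_Joshi` for every lift at `w` from an Ansatz point `z`. [folklore] -/
theorem liftsAt_subset_thetaLocusBE (w : A.V) {z : Fin A.lstar → A.Arith} (hz : z ∈ A.adelicAnsatz) :
    𝔇.liftsAt w z ⊆ 𝔇.thetaLocusBE w := fun _ hΞ =>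
  mem_iUnion₂.2 ⟨z, hz, hΞ⟩

/-- (6.6.1.2): at `w ∈ V^{odd,ss}` the locus consists exactly of the admissible lifts at `w` for the points of `Σ̃_{L′}` (T-10's
`IsAdmissibleLiftAt`). [folklore] -/
theorem thetaLocusBE_of_mem {w : A.V} (hw : w ∈ A.Voddss) :
    𝔇.thetaLocusBE w = {Ξ | ∃ z, A.IsAdmissibleLiftAt w (𝔇.lift w) z Ξ} := by
  ext Ξ
  simp only [thetaLocusBE, mem_iUnion, mem_setOf_eq, exists_prop]
  exact ⟨fun ⟨z, hz, h⟩ => ⟨z, (𝔇.mem_liftsAt_iff_isAdmissibleLiftAt hw hz Ξ).1 h⟩,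
    fun ⟨z, h⟩ => ⟨z, h.1, (𝔇.mem_liftsAt_iff_isAdmissibleLiftAt hw h.1 Ξ).2 h⟩⟩

/-- (6.6.1.3): at `w ∉ V^{odd,ss}` the locus is `{([1],…,[1])}` — print's «`=`» uses `Σ̃_{L′} ≠ ∅` (it contains the standard point
`z_Θ`, §4.4–4.5, slot T-08), made explicit here. [folklore] -/
theorem thetaLocusBE_of_not_mem {w : A.V} (hw : w ∉ A.Voddss) (hne : A.adelicAnsatz.Nonempty) :
    𝔇.thetaLocusBE w = {𝔇.trivialLift w} := by
  obtain ⟨z₀, hz₀⟩ := hne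
  refine Subset.antisymm (iUnion₂_subset fun z _ => by rw [𝔇.liftsAt_of_not_mem hw]) ?_
  rw [← 𝔇.liftsAt_of_not_mem hw z₀]
  exact 𝔇.liftsAt_subset_thetaLocusBE w hz₀

/-- `Θ̃^{B_E}_Joshi ≠ ∅` at every place, granted `Σ̃_{L′} ≠ ∅` and Teichmüller lifts. [folklore] -/
theorem thetaLocusBE_nonempty (hT : ∀ w, (𝔇.lift w).TeichLiftExists) (hne : A.adelicAnsatz.Nonempty) (w : A.V) :
    (𝔇.thetaLocusBE w).Nonempty :=
  let ⟨_, hz⟩ := hne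
  (𝔇.liftsAt_nonempty hT hz w).mono (𝔇.liftsAt_subset_thetaLocusBE w hz)

/-- Every element of the locus at `w ∈ V^{odd,ss}` reduces, coordinatewise, to the theta values of the `w`-component of its
Ansatz point (Prop. 6.6.1's derived part, read on the locus). [folklore] -/
theorem exists_resid_eq_xi_of_mem_thetaLocusBE {w : A.V} (hw : w ∈ A.Voddss) {Ξ : Fin A.lstar → B w}
    (hΞ : Ξ ∈ 𝔇.thetaLocusBE w) :
    ∃ z ∈ A.adelicAnsatz, ∀ j, (𝔇.lift w).resid (A.wComponent z w j) (Ξ j) = (𝔇.lift w).xi (A.wComponent z w j) := by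
  obtain ⟨z, hz⟩ := (Set.ext_iff.1 (𝔇.thetaLocusBE_of_mem hw) Ξ).1 hΞ
  exact ⟨z, hz.1, fun j => (𝔇.lift w).resid_of_isAdmissibleLift hz.2.2 j⟩

end AdelicLiftDatum

end Summit.ABC.IUTFork.Joshi.ATS3

end
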